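import Literature.MathematicalPhysics.QuantumFieldTheory.Balaban1983to89.B11Eq72Concrete
import Literature.MathematicalPhysics.QuantumFieldTheory.Balaban1983to89.B11Prop3Model

/-!
# `Balaban1983to89.B11Prop3Concrete` — T. Bałaban, *The variational problem and background fields in renormalization group method for
lattice gauge theories*, Commun. Math. Phys. **102** (1985) 277–309 [Balaban1985Variational], **Proposition 3** (Sect. C, p. 289)
**FOR THE CONCRETE REMAINDER `C_j(U₀, ·)` OF [4] ON THE `ℤᵈ` CARRIER**: the three [4]-inputs of the printed proof — (44) «Proposition 4
of [4]» (quadratic bound, analyticity), (72) «Proposition 5 of [4]» (bound of `(δ/δA)C`) — which r08's model instance `B11Prop3Model`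
carries as the HYPOTHESIS structure `Inputs` (its reading of (14) at the background `U₀`), are DISCHARGED for `B11Eq44Concrete.Cmap` at every
regular background; the input (46) «Theorem 3.12 from [5]» stays the hypothesis `‖HX‖ ≤ B₀‖X‖` on the abstract operator `H` of [5]

statement-level skeleton of published theorems with citation tags; proofs where landed; nothing here is a claim about the Yang–Mills mass gap

PDF held: `paper:balaban1985-cmp102-variational-background` (journal page = PDF page + 276); Sect. C pp. 285–289 [PDF 9–13] (text layer
`p0009.txt`–`p0013.txt`; renders `run/shared/lean/pub/pub-balaban/b2b-balaban-ref1/pages/1985-cmp102-variational-background/…-p009-x2.png`–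
`p013-x2.png`, read by this lineage in gens 3 and 6); [4] = T. Bałaban, *Averaging operations for lattice gauge theories*, CMP **98** (1985)
17–51 [Balaban1985Averaging], Props. 4–5 pp. 38–42 (`paper:balaban1985-cmp98-averaging`).

CITATION HEADER / WHAT IS REPRODUCED.  Mega-formalization `lit-balaban`, HOME `run/shared/lean/pub/lit-balaban/`, reader/typer/fold-owner seat
r08 gen 10 (unit `lit-balaban-r08`; TAKING line HOME/STATUS.md 2026-08-21T20:22Z).  SKELETON row **B11.Prop3** (decl of record
`B11.Prop3Printed`, typed-existing; r08 g6 `B11Prop3Model.prop3Printed_model` = the typed statement INHABITED for the model family of Sect. C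
data, kind «model-instance», with (44)/(46)/(72) as the hypothesis structure `B11Prop3Model.Inputs`).  THE PRINT (p. 289 [PDF 13], verbatim):
*"Let us gather the results of this section in Proposition 3. The transformation (47) satisfying the identity (48), i.e. linearizing the
averaging operation Q(ηA), is defined and analytic for A′ satisfying (43) with ε₃ sufficiently small (e.g. 18C₂B₀dc₁(½)ε₃ ≤ 1, 2ε₃ ≤ c₄).
The range of this transformation contains the set (43) with ε₂ ≤ ¼ε₃, and is contained in the corresponding set with 2ε₃ instead of ε₂.
The function D(A′) satisfies the bound (55) and its functional derivative satisfies the bound (73)."*  The inputs (p. 285 [PDF 9]): (44) *"The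
Proposition 4 of [4] implies Q_j(ηA) = L^jηQ_jA + C_j(L^jηA), |C_j(L^jηA)| ≤ C₂(L^jη)²|A|². (44)"* — the analyticity of `C_j` and its radius
are NOT words of (44): they are [4] Prop. 4 p. 38 *"There exist constants C₂, c₄ such that for α₀, α₁ ≤ c₄ the function Q_k(U₀,ηA,c) … is an
analytic function of the variables A_b …"* with (135) *"|C_k(U₀,A)| ≤ C₂|A|² < C₂α₁²"*, read here at the tree radius `2c₄ = b` (M3′) —, (46)
*"the Theorem 3.12 from [5] implies |HB| ≤ B₀(L^jη)⁻¹|B|, |∇HB| ≤ B₀(L^jη)⁻²|B|"*, (72) (p. 289) *"Proposition 5 of [4] implies that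
|L^jη(δ/δA)C(L^jη(A′ − HD(A′)))| ≤ L^jη(L^jη)^{−d}C₃2ε₃"*.
(v1.2 DOCFIX, r08 gen 28: the v1/v1.1 header carried «implies that it is an analytic function of A and … where |A| < 2c₄(L^jη)⁻¹» INSIDE the
(44) quotation — reader r12 g19 QUOTE-AUDIT-B15 §E X1 (a); those words are not printed at (44) p. 285 (page image checked); replaced by the
verbatim display and the [4] Prop. 4 p. 38 attribution; statements and proofs byte-identical.)

WHAT THIS FILE PROVES (theorems only; kernel-checked, 0 sorry, standard axioms), for `j ≤ k` in the regime of
`B11Eq44Concrete`/`B11Eq72Concrete` (regular background `U₀` on `ℤᵈ` — [4] (52) `pdev U₀ < α₀L⁻²ᵏ` with values in an averaging-closed subgroup `G` —,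
witness radius `b` of [4] Props 4–5, their smallness `hsmall`/`hc₃`/`h145`/`h155`):
* §1 THE INPUTS DISCHARGED: `hasFDerivAt_Cmap_zero`/`fderiv_Cmap_zero` ((44) ⇒ `DC_j(0) = 0`), **`opNorm_fderiv_Cmap_le_of_norm_lt`** ((72) in
  operator norm, LINEAR in the argument: `‖(δC_j/δA)(Y)‖ ≤ 2d·C₃(Lʲ)²·‖Y‖` for `‖Y‖ < b`, from p06's componentwise `opNorm_fderiv_Cmap_le_72` at the
  radius `‖Y‖/2`), `contDiffOn_Cmap` ([4] Prop. 4 «analytic», p06's `analyticOnNhd_Cmap`), and **`inputs_concrete :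
  B11Prop3Model.Inputs (Cmap L U₀ S T j) H (C₂(Lʲ)²) (2dC₃(Lʲ)²) B₀ (b/2)`** for EVERY linear `H` with `‖HX‖ ≤ B₀‖X‖`.
* §2 **PROPOSITION 3 AT A REGULAR BACKGROUND, CONCRETE** — `prop3_concrete`: for `0 < ε₃` with the printed smallness read in tree units
  («18·C₂(Lʲ)²·B₀·d·c₁(½)·ε₃ ≤ 1», «2ε₃ ≤ c₄» with `c₄ = b/2`) and `D = B11Prop3Model.Dfix (Cmap …) H (C₂(Lʲ)²)` (r08's selector of THE solution
  of (49)): (i) (49) holds on `‖A′‖ < ε₃` and `A′ ↦ A′ − HD(A′)` is holomorphic along every complex line there («defined and analytic»); (ii) the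
  range contains `‖A‖ < ε₂` for `ε₂ ≤ ¼ε₃` (the explicit preimage `A + HC_j(A)` of (59)–(62)); (iii) it maps `‖A′‖ < ε₃` into `‖·‖ < 2ε₃`
  ((57)–(58)); (iv) (55) `‖D(A′)‖ ≤ 4C₂(Lʲ)²‖A′‖²`; (v) (73) AT NORM LEVEL `‖(δ/δA′)D(A′)‖ ≤ 4·(2dC₃(Lʲ)²)·ε₃` (Fréchet derivative exists) —
  the range statements (ii)/(iii) and (v) are on the concrete carrier for the first time (p06's files: (49)–(56), (63)–(70), (72)).
* §3 GLUE WITH p06's ARBITRARY `D̃`: `Dt_eq_Dfix` (any map with the fixed-point characterization (49)+(55)-ball on `‖A′‖ < ε` IS r08's selector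
  there — uniqueness clause of `B13Contraction113.exists_unique_fixedPoint`), `Dt_eventuallyEq_Dfix`, **`norm_fderiv_Dt_le_73`** ((73) at norm
  level for the `𝔇 = (δ/δA′)D̃` of `B11Eq70Concrete.eq70_concrete`).
* §4 THE TYPED STATEMENT OF RECORD: the concrete Sect. C `LinDatum` `δ` (structure literal with `Ct U₀ := Cmap L U₀ S T j`, `hop U₀ := H(U₀)`
  abstract), **`prop3Printed_concrete : B11.Prop3Printed C₁ B₃ (C₂(Lʲ)²) (2dC₃(Lʲ)²) B₀ c1h (b/2) δ₀ (fun i => (δ i).toLGData …)`** (=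
  `prop3Printed_model` at the concrete family; families over any index type with bond sets `S i`, `T i` and operators `H i`), and
  **`sat14_concrete`**: the hypothesis `Sat14 … U₀` (= `Inputs`) of that inhabited statement HOLDS at every regular background `U₀` — the
  NON-VACUITY of (14)-as-read at genuine lattice data, so the five conclusions of `B11.Prop3Printed` are in force there (`prop3Printed_concrete_at`).

READINGS / HONEST SCOPE (those of `B11Prop3Model` (M1)–(M7) with the following concretions).  (M1′) TREE UNITS (as `B11Eq44Concrete`): ONE
scale `j`, the sup norms of `𝔸^S ∋ A′` and `𝔸^T ∋ D(A′)`; the (43)-weights `(L^jη)^{1,2}` and the bond weight `(L^jη)^{−d}` of (72) are absorbed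
into the constants — print's `C₂`, `C₃` become `C₂(Lʲ)²` (`C₂ = 8C₁e^{4cα₀}` of [4] (135) at a general background) and `2d·C₃(Lʲ)²` (the count
`Σ_s kerQdd(c,s) ≤ 2d` of [4] (141)/(142) times `C₃ = C3Gen d L` of [4] (157)); accordingly the printed «18C₂B₀dc₁(½)ε₃ ≤ 1» is consumed with
`C₂ ↦ C₂(Lʲ)²`.  (M3′) `c₄ := b/2` with `b` the witness radius of p06's regime, so that the model's radius `2c₄` is `b` and «2ε₃ ≤ c₄» reads
`4ε₃ ≤ b` (stronger than the `3ε₃ < b` of `B11Eq70Concrete`).  (M6) (73) at NORM LEVEL only: the decay `e^{−½δ₀d(c₋,y)}` and the kernel form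
(71) need the kernel bound of `H` from [5] Thm 3.12 — `H` is ABSTRACT here with (46) as hypothesis (rows B11.Eq45/B11.Eq70–73; NE9 letters
(L4)/(L5), socket C19′ frozen; the kernel locality of `(δC_j/δA)` itself IS concrete: `B11Eq72Concrete.fderiv_Cmap_single_eq_zero`).  `1 ≤ d` is
a hypothesis where the `LGData` carrier needs it.  NOT CLAIMED: anything about `H(U₀)` of [5], the block geometry `Λ_j`/`𝔅_k`, the identity (48)
(definition of `H`, [5]), summit progress.  Imports `B11Eq72Concrete` (p06 g6; transitively `B11Eq44Concrete`, `B12SecondOrder267Concrete`,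
`B11Eq70Concrete`) and `B11Prop3Model` (r08 g6); modifies nothing; no new named fact (net debt delta 0).
-/

noncomputable section

open scoped BigOperators Topology
open NormedSpace Finset Metric Filter

namespace Literature.MathematicalPhysics.QuantumFieldTheory.Balaban1983to89.B11Prop3Concrete

open B7Prop1Explicit B7Prop1Local B7Prop2Explicit B7Prop3Flat B7Prop4Flat B7Eq92Concrete B7Prop3GeneralLinear
  B7Prop4GeneralLevels B7Prop5GeneralOperators B7Prop5GeneralInduction B7Prop5GeneralLevels B7Prop5General B7Ineq149Pairing
  B13Contraction113 B11Eq44Concrete B12SecondOrder267Concrete B11Eq70Concrete B11Eq72Concrete B11Prop3Model B12Lineariz267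

-- `Site` alone would resolve to the torus sites of `Setup.lean`; re-export the `ℤ^d` sites of `B7Prop1Explicit`.
export B7Prop1Explicit (Site)

variable {d : ℕ}

section Regime

variable {𝔸 : Type*} [NormedRing 𝔸] [NormedAlgebra ℂ 𝔸] [CompleteSpace 𝔸] [NormOneClass 𝔸]

variable (L : ℕ) (hL : 2 ≤ L) {G : Subgroup 𝔸ˣ} (hG : AvgClosed d L G) (k : ℕ)
  (U₀ : Site d → Fin d → 𝔸ˣ) (hU₀ : ∀ x κ, U₀ x κ ∈ G) {α₀ : ℝ} (hα : 0 < α₀)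
  (hα3 : C0 d * α₀ ≤ 1 / 3) (hα4 : 4 * α₀ ≤ c2' d L) (h52 : pdev U₀ < α₀ * (((L : ℝ) ^ k)⁻¹) ^ 2)
  {b : ℝ} (hb : 0 < b)
  (hsmall : Real.exp (4 * (800 * ((d : ℝ) + 1) ^ 2 * ((d : ℝ) + 4)) * α₀)
    * (1 + 8 * (131072 * ((d : ℝ) + 1) ^ 2) * ((L : ℝ) ^ k * b)) ≤ 2)
  (hc₃ : 4 * ((L : ℝ) ^ k * b) < c3 d L)
  (h145 : 8 * d * thetaGen d L α₀ * (L : ℝ)⁻¹ ^ 4 ≤ 1)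
  (h155 : (2 * (L : ℝ) - 1) * (L : ℝ)⁻¹ ^ 2 + 2 * d * thetaGen d L α₀ * (L : ℝ)⁻¹ ^ 3
    + 1 / 8 * (1 + 2 * d * thetaGen d L α₀ * (L : ℝ)⁻¹ ^ 2 + 2 * d * C3Gen d L * ((L : ℝ) ^ k * b)) * (L : ℝ)⁻¹ ^ 2 ≤ 1)
  (S T : Finset (Site d × Fin d))

-- print's `C₂` of (44) = [4] (135) at a general background (`B7Eq123General.prop4_general` (i)), `8·C₁·e^{4cα₀}`, and print's `C₃` of
-- (72) in tree units, `2d·C₃·(Lʲ)²` (`C₃ = C3Gen d L` of [4] (157), `2d` = the count of [4] (141)/(142)), are WRITTEN OUT below (no local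
-- notation, as `B11Eq72Concrete`): `C₂(Lʲ)²` = `(8 * (131072 * (d+1)^2) * Real.exp (4 * (800 * (d+1)^2 * (d+4)) * α₀)) * (L^j)^2`,
-- `2dC₃(Lʲ)²` = `2 * d * (C3Gen d L * (L^j)^2)`.

omit [NormedAlgebra ℂ 𝔸] [CompleteSpace 𝔸] [NormOneClass 𝔸] in
/-- `C₃ ≥ 0`. [folklore] -/
private theorem C3Gen_nonneg (d L : ℕ) : 0 ≤ C3Gen d L := by
  unfold C3Gen C1ppGen; positivity

/-! ## §1 The inputs (44), (72) of Proposition 3, discharged for the concrete `C_j` -/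

include hL hG hU₀ hα hα3 hα4 h52 hb hsmall hc₃ in
/-- **(44) ⇒ the derivative of `C_j(U₀, ·)` at the origin vanishes**: `‖C_j(A)‖ ≤ C₂(Lʲ)²‖A‖²` for `‖A‖ < b` (p06's `norm_Cmap_le`) and
`C_j(0) = 0` make `A ↦ C_j(A)` little-o of `A` at `0`, i.e. `HasFDerivAt Cmap 0 0` («a power series expansion … begins with second order
terms», p. 286). [cite: Balaban1985Variational, (44) p.285, (55) p.286] [cite: Balaban1985Averaging, (135) p.38] -/
theorem hasFDerivAt_Cmap_zero {j : ℕ} (hj : j ≤ k) :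
    HasFDerivAt (Cmap L U₀ S T j) (0 : (S → 𝔸) →L[ℂ] (T → 𝔸)) 0 := by
  rw [hasFDerivAt_iff_isLittleO_nhds_zero]
  simp only [zero_add, _root_.zero_apply, sub_zero,
    Cmap_zero L hL hG k U₀ hU₀ hα hα3 hα4 h52 hb hsmall hc₃ S T hj]
  rw [Asymptotics.isLittleO_iff]
  intro c hc
  obtain ⟨K, hK⟩ : ∃ K : ℝ, K = (8 * (131072 * ((d : ℝ) + 1) ^ 2) * Real.exp (4 * (800 * ((d : ℝ) + 1) ^ 2 * ((d : ℝ) + 4)) * α₀)) * ((L : ℝ) ^ j) ^ 2 := ⟨_, rfl⟩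
  have hK0 : 0 ≤ K := by rw [hK]; positivity
  have hK1 : 0 < K + 1 := by linarith
  have hr : 0 < min b (c / (K + 1)) := lt_min hb (div_pos hc hK1)
  filter_upwards [Metric.ball_mem_nhds (0 : S → 𝔸) hr] with h hh
  rw [mem_ball_zero_iff, lt_min_iff] at hh
  have h44 := norm_Cmap_le L hL hG k U₀ hU₀ hα hα3 hα4 h52 hb hsmall hc₃ S T hj hh.1
  rw [← hK] at h44
  have hKh : K * ‖h‖ ≤ c := by
    have h1 : K * ‖h‖ ≤ K * (c / (K + 1)) := mul_le_mul_of_nonneg_left hh.2.le hK0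
    have h2 : K * (c / (K + 1)) ≤ c := by
      rw [mul_div_assoc', div_le_iff₀ hK1]
      nlinarith
    exact h1.trans h2
  calc ‖Cmap L U₀ S T j h‖ ≤ K * ‖h‖ ^ 2 := h44
    _ = (K * ‖h‖) * ‖h‖ := by ring
    _ ≤ c * ‖h‖ := mul_le_mul_of_nonneg_right hKh (norm_nonneg _)

include hL hG hU₀ hα hα3 hα4 h52 hb hsmall hc₃ in
/-- `(δC_j/δA)(0) = 0`. [cite: Balaban1985Variational, (44) p.285, (55) p.286] -/
theorem fderiv_Cmap_zero {j : ℕ} (hj : j ≤ k) : fderiv ℂ (Cmap L U₀ S T j) 0 = 0 :=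
  (hasFDerivAt_Cmap_zero L hL hG k U₀ hU₀ hα hα3 hα4 h52 hb hsmall hc₃ S T hj).fderiv

include hL hG hU₀ hα hα3 hα4 h52 hb hsmall hc₃ h145 h155 in
/-- **(72) IN OPERATOR NORM, LINEAR IN THE ARGUMENT, CONCRETE** — the `deriv_le` input of `B11Prop3Model.Inputs`: `‖(δC_j/δA)(Y)‖ ≤ 2d·C₃(Lʲ)²·‖Y‖`
for every `Y ∈ 𝔸^S` with `‖Y‖ < b` ([4] Prop. 5 (157) with the count (141)/(142), p06's componentwise `opNorm_fderiv_Cmap_le_72` at the radius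
`ε = ‖Y‖/2`; at `Y = 0` by `fderiv_Cmap_zero`). [cite: Balaban1985Variational, (72) p.289] [cite: Balaban1985Averaging, (157) p.42, (141)–(142) p.39] -/
theorem opNorm_fderiv_Cmap_le_of_norm_lt {j : ℕ} (hj : j ≤ k) {Y : S → 𝔸} (hY : ‖Y‖ < b) :
    ‖fderiv ℂ (Cmap L U₀ S T j) Y‖ ≤ (2 * (d : ℝ) * (C3Gen d L * ((L : ℝ) ^ j) ^ 2)) * ‖Y‖ := by
  have hC3 := C3Gen_nonneg d L
  by_cases hY0 : Y = 0
  · subst hY0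
    rw [fderiv_Cmap_zero L hL hG k U₀ hU₀ hα hα3 hα4 h52 hb hsmall hc₃ S T hj, ContinuousLinearMap.opNorm_zero]
    exact mul_nonneg (mul_nonneg (by positivity) (mul_nonneg hC3 (by positivity))) (norm_nonneg _)
  have hpos : 0 < ‖Y‖ := norm_pos_iff.mpr hY0
  have hε0 : 0 < ‖Y‖ / 2 := by positivity
  have hε : 2 * (‖Y‖ / 2) ≤ b := by linarith
  have hX₀ : ‖Y‖ ≤ 2 * (‖Y‖ / 2) := by linarith
  have hM : 0 ≤ (2 * (d : ℝ) * (C3Gen d L * ((L : ℝ) ^ j) ^ 2)) * ‖Y‖ :=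
    mul_nonneg (mul_nonneg (by positivity) (mul_nonneg hC3 (by positivity))) (norm_nonneg _)
  refine ContinuousLinearMap.opNorm_le_bound _ hM fun h => ?_
  rw [pi_norm_le_iff_of_nonneg (mul_nonneg hM (norm_nonneg _))]
  intro c
  have hc := opNorm_fderiv_Cmap_le_72 L hL hG k U₀ hU₀ hα hα3 hα4 h52 hb hsmall hc₃ h145 h155 S T hj hε0 hε hX₀ c
  calc ‖fderiv ℂ (Cmap L U₀ S T j) Y h c‖
      = ‖((ContinuousLinearMap.proj (R := ℂ) c).comp (fderiv ℂ (Cmap L U₀ S T j) Y)) h‖ := rfl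
    _ ≤ ‖(ContinuousLinearMap.proj (R := ℂ) c).comp (fderiv ℂ (Cmap L U₀ S T j) Y)‖ * ‖h‖ :=
        ContinuousLinearMap.le_opNorm _ _
    _ ≤ 2 * d * (C3Gen d L * (((L : ℝ) ^ j) ^ 2 * (2 * (‖Y‖ / 2)))) * ‖h‖ :=
        mul_le_mul_of_nonneg_right hc (norm_nonneg _)
    _ = (2 * (d : ℝ) * (C3Gen d L * ((L : ℝ) ^ j) ^ 2)) * ‖Y‖ * ‖h‖ := by ring

include hL hG hU₀ hα hα3 hα4 h52 hb hsmall hc₃ in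
/-- **[4] Prop. 4 «is an analytic function of the variables A_b» (the `C_j` of (44)) ⇒ `C¹`** on the ball `‖A‖ < b` — the `contDiff` input
of `B11Prop3Model.Inputs` (p06's `analyticOnNhd_Cmap`, [4] Prop. 4 p. 38; analytic ⇒ `Cⁿ` for every `n` into the complete space `𝔸^T`).
[cite: Balaban1985Variational, (44) p.285] [cite: Balaban1985Averaging, Prop. 4 p.38] -/
theorem contDiffOn_Cmap {j : ℕ} (hj : j ≤ k) {n : WithTop ℕ∞} :
    ContDiffOn ℂ n (Cmap L U₀ S T j) {Y : S → 𝔸 | ‖Y‖ < b} :=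
  (analyticOnNhd_Cmap L hL hG k U₀ hU₀ hα hα3 hα4 h52 hb hsmall hc₃ S T hj).contDiffOn_of_completeSpace

variable (H : (T → 𝔸) →ₗ[ℂ] (S → 𝔸)) {B₀ : ℝ}

include hL hG hU₀ hα hα3 hα4 h52 hb hsmall hc₃ h145 h155 in
/-- **THE INPUTS OF PROPOSITION 3, DISCHARGED FOR THE CONCRETE `C_j`**: r08 g6's hypothesis structure `B11Prop3Model.Inputs C H C₂ C₃ B₀ c₄` —
(46) `‖HX‖ ≤ B₀‖X‖`, (44) `‖C(Y)‖ ≤ C₂‖Y‖²` and `C ∈ C¹` on `‖Y‖ < 2c₄`, (72) `‖C′(Y)‖ ≤ C₃‖Y‖` there — HOLDS for `C := Cmap L U₀ S T j` with the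
tree-unit constants `C₂(Lʲ)²`, `2dC₃(Lʲ)²`, `c₄ := b/2`, for every linear `H` obeying (46) ([4] Props 4–5 concretely: p06's `norm_Cmap_le`,
`analyticOnNhd_Cmap`, `opNorm_fderiv_Cmap_le_72`; [5] Thm 3.12 = the hypothesis `hH`). [cite: Balaban1985Variational, (44)–(46) p.285, (72) p.289]
[cite: Balaban1985Averaging, Prop. 4 p.38, Prop. 5 p.42] -/
theorem inputs_concrete {j : ℕ} (hj : j ≤ k) (hH : ∀ X, ‖H X‖ ≤ B₀ * ‖X‖) :
    Inputs (Cmap L U₀ S T j) H ((8 * (131072 * ((d : ℝ) + 1) ^ 2) * Real.exp (4 * (800 * ((d : ℝ) + 1) ^ 2 * ((d : ℝ) + 4)) * α₀)) * ((L : ℝ) ^ j) ^ 2) (2 * (d : ℝ) * (C3Gen d L * ((L : ℝ) ^ j) ^ 2)) B₀ (b / 2) where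
  norm_H := hH
  quad Y hY := norm_Cmap_le L hL hG k U₀ hU₀ hα hα3 hα4 h52 hb hsmall hc₃ S T hj (by linarith)
  contDiff := by
    have h2 : {Y : S → 𝔸 | ‖Y‖ < 2 * (b / 2)} = {Y : S → 𝔸 | ‖Y‖ < b} := by
      ext Y; simp only [Set.mem_setOf_eq]; constructor <;> intro h <;> linarith
    rw [h2]
    exact contDiffOn_Cmap L hL hG k U₀ hU₀ hα hα3 hα4 h52 hb hsmall hc₃ S T hj
  deriv_le Y hY :=
    opNorm_fderiv_Cmap_le_of_norm_lt L hL hG k U₀ hU₀ hα hα3 hα4 h52 hb hsmall hc₃ h145 h155 S T hj (by linarith)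

/-! ## §2 Proposition 3 at a regular background, for the concrete `C_j` and r08's selector `D = Dfix` -/

omit [NormedAlgebra ℂ 𝔸] [CompleteSpace 𝔸] [NormOneClass 𝔸] in
/-- The smallness arithmetic in tree units: from «18·C₂(Lʲ)²·B₀·d·c₁(½)·ε₃ ≤ 1» with `1 ≤ d`, `1 ≤ c₁(½)` and «2ε₃ ≤ c₄ = b/2», `0 < b`:
`9C₂(Lʲ)²B₀ε₃ < 1` (contraction (54)), `4C₂(Lʲ)²B₀ε₃ ≤ 1` (self-map), `18C₂(Lʲ)²B₀ε₃ ≤ 1`, `3ε₃ ≤ 2(b/2)`, `3ε₃ < 2(b/2)`, `4ε₃ ≤ b`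
(`B11Prop3Model.smallness`). [cite: Balaban1985Variational, Prop. 3 p.289, (54) p.286] -/
theorem smallness_concrete {K B₀ dd c1h ε b : ℝ} (hK : 0 ≤ K) (hB₀ : 0 ≤ B₀) (hε : 0 ≤ ε) (hd : 1 ≤ dd) (hc1h : 1 ≤ c1h)
    (hb : 0 < b) (h18 : 18 * K * B₀ * dd * c1h * ε ≤ 1) (h2 : 2 * ε ≤ b / 2) :
    9 * K * B₀ * ε < 1 ∧ 4 * K * B₀ * ε ≤ 1 ∧ 18 * K * B₀ * ε ≤ 1 ∧ 3 * ε ≤ 2 * (b / 2) ∧ 3 * ε < 2 * (b / 2) ∧ 4 * ε ≤ b := by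
  obtain ⟨hq, hR2, hRC, hR⟩ := B11Prop3Model.smallness hK hB₀ hε hd hc1h (by positivity : 0 < b / 2) h18 h2
  have h18' : 18 * K * B₀ * ε ≤ 1 := by
    have hdc : 1 ≤ dd * c1h := by nlinarith
    have h0 : 0 ≤ 18 * K * B₀ * ε := by positivity
    have : 18 * K * B₀ * ε * 1 ≤ 18 * K * B₀ * ε * (dd * c1h) := mul_le_mul_of_nonneg_left hdc h0
    nlinarith
  exact ⟨hq, hR2, h18', hRC, hR, by linarith⟩

include hL hG hU₀ hα hα3 hα4 h52 hb hsmall hc₃ h145 h155 in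
/-- **PROPOSITION 3 (p. 289) FOR THE CONCRETE `C_j(U₀, ·)` OF [4] AT A REGULAR BACKGROUND `U₀`**, `H` linear with (46) `‖HX‖ ≤ B₀‖X‖`, `1 ≤ d`,
`1 ≤ c₁(½)`, `0 < ε₃` with the printed smallness in tree units «18·C₂(Lʲ)²·B₀·d·c₁(½)·ε₃ ≤ 1», «2ε₃ ≤ c₄» (`c₄ = b/2`), and
`D := B11Prop3Model.Dfix (Cmap L U₀ S T j) H (C₂(Lʲ)²)` (THE solution of (49) «C_j(L^jηA′ − L^jηHD(A′)) = D(A′)» in every admissible ball):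
(i) «defined and analytic»: (49) holds for `‖A′‖ < ε₃` and `σ ↦ (P + σQ) − HD(P + σQ)` is holomorphic on `{σ : ‖P + σQ‖ < ε₃}` for all `P, Q`;
(ii) «the range … contains the set (43) with ε₂ ≤ ¼ε₃»: every `A` with `‖A‖ < ε₂` is `A′ − HD(A′)` for some `‖A′‖ < ε₃` (namely `A′ = A + HC_j(A)`,
(59)–(62)); (iii) «is contained in the corresponding set with 2ε₃»: `‖A′ − HD(A′)‖ < 2ε₃` ((57)–(58)); (iv) (55) `‖D(A′)‖ ≤ 4C₂(Lʲ)²‖A′‖²`;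
(v) (73) at norm level: `D` is Fréchet-differentiable at `A′` and `‖(δ/δA′)D(A′)‖ ≤ 4·(2dC₃(Lʲ)²)·ε₃` ((70)–(72): `‖(I + ℜ)⁻¹‖ ≤ 2`, `‖𝒞′‖ ≤ C₃·2ε₃`).
Proof: r08 g6's `B11Prop3Model` lemmas (`Dfix_spec`/`Dfix_ball`/`Dfix_fix`/`norm_fderiv_Dfix_le`) and the lineage's `B12Lineariz267`
(`differentiableOn_Dt_line`, `phi_psi_of_norm_lt`, `mapsTo_phi`) fed with `inputs_concrete`. [cite: Balaban1985Variational, Prop. 3 p.289]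
[cite: Balaban1985Averaging, Prop. 4 p.38, Prop. 5 p.42] -/
theorem prop3_concrete {j : ℕ} (hj : j ≤ k) (hd : 1 ≤ d) (hB₀ : 0 ≤ B₀) (hH : ∀ X, ‖H X‖ ≤ B₀ * ‖X‖) {c1h ε : ℝ}
    (hc1h : 1 ≤ c1h) (hε : 0 < ε) (h18 : 18 * ((8 * (131072 * ((d : ℝ) + 1) ^ 2) * Real.exp (4 * (800 * ((d : ℝ) + 1) ^ 2 * ((d : ℝ) + 4)) * α₀)) * ((L : ℝ) ^ j) ^ 2) * B₀ * d * c1h * ε ≤ 1) (h2 : 2 * ε ≤ b / 2) :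
    (∀ A' : S → 𝔸, ‖A'‖ < ε →
        Cmap L U₀ S T j (A' - H (Dfix (Cmap L U₀ S T j) H ((8 * (131072 * ((d : ℝ) + 1) ^ 2) * Real.exp (4 * (800 * ((d : ℝ) + 1) ^ 2 * ((d : ℝ) + 4)) * α₀)) * ((L : ℝ) ^ j) ^ 2) A')) =
          Dfix (Cmap L U₀ S T j) H ((8 * (131072 * ((d : ℝ) + 1) ^ 2) * Real.exp (4 * (800 * ((d : ℝ) + 1) ^ 2 * ((d : ℝ) + 4)) * α₀)) * ((L : ℝ) ^ j) ^ 2) A') ∧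
    (∀ P Q : S → 𝔸, DifferentiableOn ℂ
        (fun σ : ℂ => (P + σ • Q) - H (Dfix (Cmap L U₀ S T j) H ((8 * (131072 * ((d : ℝ) + 1) ^ 2) * Real.exp (4 * (800 * ((d : ℝ) + 1) ^ 2 * ((d : ℝ) + 4)) * α₀)) * ((L : ℝ) ^ j) ^ 2) (P + σ • Q)))
        {σ : ℂ | ‖P + σ • Q‖ < ε}) ∧
    (∀ ε₂ : ℝ, ε₂ ≤ ε / 4 → ∀ A : S → 𝔸, ‖A‖ < ε₂ →
        ∃ A' : S → 𝔸, ‖A'‖ < ε ∧ A' - H (Dfix (Cmap L U₀ S T j) H ((8 * (131072 * ((d : ℝ) + 1) ^ 2) * Real.exp (4 * (800 * ((d : ℝ) + 1) ^ 2 * ((d : ℝ) + 4)) * α₀)) * ((L : ℝ) ^ j) ^ 2) A') = A) ∧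
    (∀ A' : S → 𝔸, ‖A'‖ < ε → ‖A' - H (Dfix (Cmap L U₀ S T j) H ((8 * (131072 * ((d : ℝ) + 1) ^ 2) * Real.exp (4 * (800 * ((d : ℝ) + 1) ^ 2 * ((d : ℝ) + 4)) * α₀)) * ((L : ℝ) ^ j) ^ 2) A')‖ < 2 * ε) ∧
    (∀ A' : S → 𝔸, ‖A'‖ < ε →
        ‖Dfix (Cmap L U₀ S T j) H ((8 * (131072 * ((d : ℝ) + 1) ^ 2) * Real.exp (4 * (800 * ((d : ℝ) + 1) ^ 2 * ((d : ℝ) + 4)) * α₀)) * ((L : ℝ) ^ j) ^ 2) A'‖ ≤ 4 * ((8 * (131072 * ((d : ℝ) + 1) ^ 2) * Real.exp (4 * (800 * ((d : ℝ) + 1) ^ 2 * ((d : ℝ) + 4)) * α₀)) * ((L : ℝ) ^ j) ^ 2) * ‖A'‖ ^ 2) ∧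
    (∀ A' : S → 𝔸, ‖A'‖ < ε →
        HasFDerivAt (Dfix (Cmap L U₀ S T j) H ((8 * (131072 * ((d : ℝ) + 1) ^ 2) * Real.exp (4 * (800 * ((d : ℝ) + 1) ^ 2 * ((d : ℝ) + 4)) * α₀)) * ((L : ℝ) ^ j) ^ 2))
            (fderiv ℂ (Dfix (Cmap L U₀ S T j) H ((8 * (131072 * ((d : ℝ) + 1) ^ 2) * Real.exp (4 * (800 * ((d : ℝ) + 1) ^ 2 * ((d : ℝ) + 4)) * α₀)) * ((L : ℝ) ^ j) ^ 2)) A') A' ∧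
          ‖fderiv ℂ (Dfix (Cmap L U₀ S T j) H ((8 * (131072 * ((d : ℝ) + 1) ^ 2) * Real.exp (4 * (800 * ((d : ℝ) + 1) ^ 2 * ((d : ℝ) + 4)) * α₀)) * ((L : ℝ) ^ j) ^ 2)) A'‖ ≤ 4 * (2 * (d : ℝ) * (C3Gen d L * ((L : ℝ) ^ j) ^ 2)) * ε) := by
  have hin := inputs_concrete L hL hG k U₀ hU₀ hα hα3 hα4 h52 hb hsmall hc₃ h145 h155 S T H hj hH
  have hK : 0 ≤ (8 * (131072 * ((d : ℝ) + 1) ^ 2) * Real.exp (4 * (800 * ((d : ℝ) + 1) ^ 2 * ((d : ℝ) + 4)) * α₀)) * ((L : ℝ) ^ j) ^ 2 := by positivity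
  have hC3 : 0 ≤ (2 * (d : ℝ) * (C3Gen d L * ((L : ℝ) ^ j) ^ 2)) := mul_nonneg (by positivity) (mul_nonneg (C3Gen_nonneg d L) (by positivity))
  have hdR : (1 : ℝ) ≤ (d : ℝ) := by exact_mod_cast hd
  obtain ⟨hq, hR2, h18', hRC, hR, h4⟩ := smallness_concrete hK hB₀ hε.le hdR hc1h hb h18 h2
  have hQ : QuadAnalytic (Cmap L U₀ S T j) ((8 * (131072 * ((d : ℝ) + 1) ^ 2) * Real.exp (4 * (800 * ((d : ℝ) + 1) ^ 2 * ((d : ℝ) + 4)) * α₀)) * ((L : ℝ) ^ j) ^ 2) (2 * (b / 2)) := hin.quadAnalytic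
  have hDball := Dfix_ball (Ct := Cmap L U₀ S T j) (hop := H) hQ hK hB₀ hH hq hRC
  have hDfix := Dfix_fix (Ct := Cmap L U₀ S T j) (hop := H) hQ hK hB₀ hH hq hRC
  refine ⟨fun A' hA' => hDfix A' hA', fun P Q => ?_, ?_, ?_, ?_, ?_⟩
  · -- (i) analyticity of A′ ↦ A′ − HD(A′) along the line P + σQ
    have hD := B12Lineariz267.differentiableOn_Dt_line hQ hK hB₀ hH hq hRC hin.prop4Hyp.differentiableOn hDball hDfix P Q
    have hlin : DifferentiableOn ℂ (fun σ : ℂ => P + σ • Q) {σ : ℂ | ‖P + σ • Q‖ < ε} :=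
      ((differentiable_id.smul_const Q).const_add P).differentiableOn
    have hcomp : DifferentiableOn ℂ
        (fun σ : ℂ => hin.hopL (Dfix (Cmap L U₀ S T j) H ((8 * (131072 * ((d : ℝ) + 1) ^ 2) * Real.exp (4 * (800 * ((d : ℝ) + 1) ^ 2 * ((d : ℝ) + 4)) * α₀)) * ((L : ℝ) ^ j) ^ 2) (P + σ • Q)))
        {σ : ℂ | ‖P + σ • Q‖ < ε} := hin.hopL.differentiable.comp_differentiableOn hD
    exact hlin.sub hcomp
  · -- (ii) the range contains ‖A‖ < ε₂ ≤ ε/4: A = Φ(A + HC(A))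
    intro ε₂ hε₂ A hA
    have hA2 : ‖A‖ < ε / 2 := by linarith
    obtain ⟨hΨ, hΦΨ⟩ := B12Lineariz267.phi_psi_of_norm_lt hQ hK hB₀ hH hq hRC hDball hDfix hA2
    exact ⟨A + H (Cmap L U₀ S T j A), hΨ, hΦΨ⟩
  · -- (iii) (57)–(58)
    intro A' hA'
    have h := B12Lineariz267.mapsTo_phi hQ hK hB₀ hH hq hRC hDball hDfix (mem_ball_zero_iff.mpr hA')
    exact mem_ball_zero_iff.mp h
  · -- (iv) (55)
    intro A' hA'
    exact (Dfix_spec hQ hK hB₀ hH hq hRC hA').1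
  · -- (v) (73) at norm level
    intro A' hA'
    exact norm_fderiv_Dfix_le hin hK hC3 hB₀ hε h18' h2 hA'

/-! ## §3 Glue with an arbitrary solution `D̃` of (49) (p06's `Dt`) -/

include hL hG hU₀ hα hα3 hα4 h52 hb hsmall hc₃ in
/-- **ANY map `D̃` with the fixed-point characterization (49) + the (55)-ball on `‖A′‖ < ε` IS r08's selector `Dfix` there** — uniqueness of
the solution of (49) in the ball `‖X‖ ≤ 4C₂(Lʲ)²ε²` (p. 286, `B13Contraction113.exists_unique_fixedPoint` for the concrete `C_j`), so every
theorem of `B11Eq70Concrete`/`B11Eq72Concrete`/`B12SecondOrder267Concrete` about such a `D̃` is a theorem about `Dfix`, and conversely.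
[cite: Balaban1985Variational, (49) p.285, (54)–(55) p.286] -/
theorem Dt_eq_Dfix {j : ℕ} (hj : j ≤ k) (hB₀ : 0 ≤ B₀) (hH : ∀ X, ‖H X‖ ≤ B₀ * ‖X‖) {ε : ℝ}
    (hq : 9 * ((8 * (131072 * ((d : ℝ) + 1) ^ 2) * Real.exp (4 * (800 * ((d : ℝ) + 1) ^ 2 * ((d : ℝ) + 4)) * α₀)) * ((L : ℝ) ^ j) ^ 2) * B₀ * ε < 1) (hε3 : 3 * ε ≤ b) {Dt : (S → 𝔸) → (T → 𝔸)}
    (hDball : ∀ B : S → 𝔸, ‖B‖ < ε → Dt B ∈ closedBall (0 : T → 𝔸) (4 * ((8 * (131072 * ((d : ℝ) + 1) ^ 2) * Real.exp (4 * (800 * ((d : ℝ) + 1) ^ 2 * ((d : ℝ) + 4)) * α₀)) * ((L : ℝ) ^ j) ^ 2) * ε ^ 2))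
    (hDfix : ∀ B : S → 𝔸, ‖B‖ < ε → Cmap L U₀ S T j (B - H (Dt B)) = Dt B) {A' : S → 𝔸} (hA' : ‖A'‖ < ε) :
    Dt A' = Dfix (Cmap L U₀ S T j) H ((8 * (131072 * ((d : ℝ) + 1) ^ 2) * Real.exp (4 * (800 * ((d : ℝ) + 1) ^ 2 * ((d : ℝ) + 4)) * α₀)) * ((L : ℝ) ^ j) ^ 2) A' := by
  have hK : 0 ≤ (8 * (131072 * ((d : ℝ) + 1) ^ 2) * Real.exp (4 * (800 * ((d : ℝ) + 1) ^ 2 * ((d : ℝ) + 4)) * α₀)) * ((L : ℝ) ^ j) ^ 2 := by positivity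
  have hQ := quadAnalytic_Cmap L hL hG k U₀ hU₀ hα hα3 hα4 h52 hb hsmall hc₃ S T hj
  obtain ⟨X, -, -, huniq⟩ := exists_unique_fixedPoint (Hop := H) hQ hK hB₀ hH hA' hq hε3
  have h1 : Dt A' = X := huniq _ (hDball A' hA') (hDfix A' hA')
  have h2 : Dfix (Cmap L U₀ S T j) H ((8 * (131072 * ((d : ℝ) + 1) ^ 2) * Real.exp (4 * (800 * ((d : ℝ) + 1) ^ 2 * ((d : ℝ) + 4)) * α₀)) * ((L : ℝ) ^ j) ^ 2) A' = X :=
    huniq _ (Dfix_ball (Ct := Cmap L U₀ S T j) (hop := H) hQ hK hB₀ hH hq hε3 A' hA')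
      (Dfix_fix (Ct := Cmap L U₀ S T j) (hop := H) hQ hK hB₀ hH hq hε3 A' hA')
  rw [h1, h2]

include hL hG hU₀ hα hα3 hα4 h52 hb hsmall hc₃ in
/-- `D̃` and `Dfix` agree on a neighbourhood of every `A′` of the open ball `‖A′‖ < ε`. [cite: Balaban1985Variational, (49) p.285, (54) p.286] -/
theorem Dt_eventuallyEq_Dfix {j : ℕ} (hj : j ≤ k) (hB₀ : 0 ≤ B₀) (hH : ∀ X, ‖H X‖ ≤ B₀ * ‖X‖) {ε : ℝ}
    (hq : 9 * ((8 * (131072 * ((d : ℝ) + 1) ^ 2) * Real.exp (4 * (800 * ((d : ℝ) + 1) ^ 2 * ((d : ℝ) + 4)) * α₀)) * ((L : ℝ) ^ j) ^ 2) * B₀ * ε < 1) (hε3 : 3 * ε ≤ b) {Dt : (S → 𝔸) → (T → 𝔸)}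
    (hDball : ∀ B : S → 𝔸, ‖B‖ < ε → Dt B ∈ closedBall (0 : T → 𝔸) (4 * ((8 * (131072 * ((d : ℝ) + 1) ^ 2) * Real.exp (4 * (800 * ((d : ℝ) + 1) ^ 2 * ((d : ℝ) + 4)) * α₀)) * ((L : ℝ) ^ j) ^ 2) * ε ^ 2))
    (hDfix : ∀ B : S → 𝔸, ‖B‖ < ε → Cmap L U₀ S T j (B - H (Dt B)) = Dt B) {A' : S → 𝔸} (hA' : ‖A'‖ < ε) :
    Dt =ᶠ[𝓝 A'] Dfix (Cmap L U₀ S T j) H ((8 * (131072 * ((d : ℝ) + 1) ^ 2) * Real.exp (4 * (800 * ((d : ℝ) + 1) ^ 2 * ((d : ℝ) + 4)) * α₀)) * ((L : ℝ) ^ j) ^ 2) := by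
  have hball : ∀ᶠ A'' in 𝓝 A', ‖A''‖ < ε := (isOpen_lt continuous_norm continuous_const).mem_nhds hA'
  filter_upwards [hball] with A'' h
  exact Dt_eq_Dfix L hL hG k U₀ hU₀ hα hα3 hα4 h52 hb hsmall hc₃ S T H hj hB₀ hH hq hε3 hDball hDfix h

include hL hG hU₀ hα hα3 hα4 h52 hb hsmall hc₃ h145 h155 in
/-- **(73) AT NORM LEVEL FOR THE `𝔇 = (δ/δA′)D̃` OF `B11Eq70Concrete`**: for any `D̃` with the fixed-point characterization on `‖A′‖ < ε₃`, under the
printed smallness in tree units and `1 ≤ d`, `1 ≤ c₁(½)`: `‖fderiv ℂ D̃ A′‖ ≤ 4·(2dC₃(Lʲ)²)·ε₃` for `‖A′‖ < ε₃` — *"The formula (70) and the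
inequalities (71), (72) give finally the following inequality"* with `‖(I + ℜ)⁻¹‖ ≤ 2` in place of the kernel bound (71) (reading (M6)).
[cite: Balaban1985Variational, (70)–(73) p.289] [cite: Balaban1985Averaging, Prop. 5 p.42] -/
theorem norm_fderiv_Dt_le_73 {j : ℕ} (hj : j ≤ k) (hd : 1 ≤ d) (hB₀ : 0 ≤ B₀) (hH : ∀ X, ‖H X‖ ≤ B₀ * ‖X‖) {c1h ε : ℝ}
    (hc1h : 1 ≤ c1h) (hε : 0 < ε) (h18 : 18 * ((8 * (131072 * ((d : ℝ) + 1) ^ 2) * Real.exp (4 * (800 * ((d : ℝ) + 1) ^ 2 * ((d : ℝ) + 4)) * α₀)) * ((L : ℝ) ^ j) ^ 2) * B₀ * d * c1h * ε ≤ 1) (h2 : 2 * ε ≤ b / 2)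
    {Dt : (S → 𝔸) → (T → 𝔸)}
    (hDball : ∀ B : S → 𝔸, ‖B‖ < ε → Dt B ∈ closedBall (0 : T → 𝔸) (4 * ((8 * (131072 * ((d : ℝ) + 1) ^ 2) * Real.exp (4 * (800 * ((d : ℝ) + 1) ^ 2 * ((d : ℝ) + 4)) * α₀)) * ((L : ℝ) ^ j) ^ 2) * ε ^ 2))
    (hDfix : ∀ B : S → 𝔸, ‖B‖ < ε → Cmap L U₀ S T j (B - H (Dt B)) = Dt B) {A' : S → 𝔸} (hA' : ‖A'‖ < ε) :
    ‖fderiv ℂ Dt A'‖ ≤ 4 * (2 * (d : ℝ) * (C3Gen d L * ((L : ℝ) ^ j) ^ 2)) * ε := by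
  have hK : 0 ≤ (8 * (131072 * ((d : ℝ) + 1) ^ 2) * Real.exp (4 * (800 * ((d : ℝ) + 1) ^ 2 * ((d : ℝ) + 4)) * α₀)) * ((L : ℝ) ^ j) ^ 2 := by positivity
  have hdR : (1 : ℝ) ≤ (d : ℝ) := by exact_mod_cast hd
  obtain ⟨hq, -, -, -, -, h4⟩ := smallness_concrete hK hB₀ hε.le hdR hc1h hb h18 h2
  have hε3 : 3 * ε ≤ b := by linarith
  have heq := Dt_eventuallyEq_Dfix L hL hG k U₀ hU₀ hα hα3 hα4 h52 hb hsmall hc₃ S T H hj hB₀ hH hq hε3 hDball hDfix hA'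
  rw [heq.fderiv_eq]
  exact ((prop3_concrete L hL hG k U₀ hU₀ hα hα3 hα4 h52 hb hsmall hc₃ h145 h155 S T H hj hd hB₀ hH hc1h hε h18 h2).2.2.2.2.2
    A' hA').2

end Regime

/-! ## §4 The typed statement of record `B11.Prop3Printed` for the concrete Sect. C family, and the non-vacuity of its hypothesis (14) -/

section Family

variable {𝔸 : Type} [NormedRing 𝔸] [NormedAlgebra ℂ 𝔸] [CompleteSpace 𝔸] [NormOneClass 𝔸]

omit [NormOneClass 𝔸] in
/-- **Proposition 3 (p. 289) — the typed statement of record `B11.Prop3Printed` INHABITED for the CONCRETE Sect. C family**: the Sect. C datum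
(r08 g6's `B11Prop3Model.LinDatum`, carriers `𝔸^S ∋ A′`, `𝔸^T ∋ D(A′)`, backgrounds `U₀ : ℤᵈ × (axes) → 𝔸ˣ`) has `Ct U₀ := Cmap L U₀ S T j` = the
remainder `C_j(U₀, ·)` of [4] (134)/(136) between the configuration spaces and `hop U₀ := H(U₀)` the operator of (45)–(46) (abstract, a parameter);
index type `I` arbitrary, per index bond sets `S i`, `T i` and an operator family `H i U₀`; constants in tree units `C₂(Lʲ)²`, `2dC₃(Lʲ)²`,
`c₄ = b/2` (readings (M1′)/(M3′)); `= B11Prop3Model.prop3Printed_model` at the concrete data (theorems only: the datum is a structure literal).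
Its hypothesis `Sat14 … U₀` (= `Inputs`) is DISCHARGED at regular backgrounds by `sat14_concrete`. [cite: Balaban1985Variational, Prop. 3 p.289]
[cite: Balaban1985Averaging, (134)–(136) pp.38–39] -/
theorem prop3Printed_concrete {I : Type} (Bdryf : I → Type) (hd : 1 ≤ d) (L : ℕ) (Sf Tf : I → Finset (Site d × Fin d)) (j : ℕ)
    (Hf : ∀ i, (Site d → Fin d → 𝔸ˣ) → ((Tf i → 𝔸) →ₗ[ℂ] (Sf i → 𝔸)))
    {C₁ B₃ B₀ c1h δ₀ α₀ b : ℝ} (hB₀ : 0 ≤ B₀) (hb : 0 < b) (hc1h : 1 ≤ c1h) :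
    let δ : ∀ i, LinDatum (Sf i → 𝔸) (Tf i → 𝔸) (Site d → Fin d → 𝔸ˣ) := fun i =>
      { L := L, dim := d, one_le_dim := hd, hop := Hf i, Ct := fun U₀ => Cmap L U₀ (Sf i) (Tf i) j }
    B11.Prop3Printed C₁ B₃
      ((8 * (131072 * ((d : ℝ) + 1) ^ 2) * Real.exp (4 * (800 * ((d : ℝ) + 1) ^ 2 * ((d : ℝ) + 4)) * α₀)) * ((L : ℝ) ^ j) ^ 2)
      (2 * (d : ℝ) * (C3Gen d L * ((L : ℝ) ^ j) ^ 2)) B₀ c1h (b / 2) δ₀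
      (fun i => (δ i).toLGData (Bdryf i)
        ((8 * (131072 * ((d : ℝ) + 1) ^ 2) * Real.exp (4 * (800 * ((d : ℝ) + 1) ^ 2 * ((d : ℝ) + 4)) * α₀)) * ((L : ℝ) ^ j) ^ 2)
        (2 * (d : ℝ) * (C3Gen d L * ((L : ℝ) ^ j) ^ 2)) B₀ (b / 2)) := by
  intro δ
  exact prop3Printed_model (fun i => (Sf i → 𝔸)) (fun i => (Tf i → 𝔸)) (fun _ => Site d → Fin d → 𝔸ˣ) Bdryf (by positivity)
    (mul_nonneg (by positivity) (mul_nonneg (by unfold C3Gen C1ppGen; positivity) (by positivity))) hB₀ (by positivity) hc1h δ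

variable (L : ℕ) (hL : 2 ≤ L) {G : Subgroup 𝔸ˣ} (hG : AvgClosed d L G) (k : ℕ)
  (U₀ : Site d → Fin d → 𝔸ˣ) (hU₀ : ∀ x κ, U₀ x κ ∈ G) {α₀ : ℝ} (hα : 0 < α₀)
  (hα3 : C0 d * α₀ ≤ 1 / 3) (hα4 : 4 * α₀ ≤ c2' d L) (h52 : pdev U₀ < α₀ * (((L : ℝ) ^ k)⁻¹) ^ 2)
  {b : ℝ} (hb : 0 < b)
  (hsmall : Real.exp (4 * (800 * ((d : ℝ) + 1) ^ 2 * ((d : ℝ) + 4)) * α₀)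
    * (1 + 8 * (131072 * ((d : ℝ) + 1) ^ 2) * ((L : ℝ) ^ k * b)) ≤ 2)
  (hc₃ : 4 * ((L : ℝ) ^ k * b) < c3 d L)
  (h145 : 8 * d * thetaGen d L α₀ * (L : ℝ)⁻¹ ^ 4 ≤ 1)
  (h155 : (2 * (L : ℝ) - 1) * (L : ℝ)⁻¹ ^ 2 + 2 * d * thetaGen d L α₀ * (L : ℝ)⁻¹ ^ 3
    + 1 / 8 * (1 + 2 * d * thetaGen d L α₀ * (L : ℝ)⁻¹ ^ 2 + 2 * d * C3Gen d L * ((L : ℝ) ^ k * b)) * (L : ℝ)⁻¹ ^ 2 ≤ 1)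
  (S T : Finset (Site d × Fin d))

include hL hG hU₀ hα hα3 hα4 h52 hb hsmall hc₃ h145 h155 in
/-- **NON-VACUITY OF (14)-AS-READ AT GENUINE LATTICE DATA**: at every regular background `U₀` of the regime and every `H(U₀)` with (46)
`‖H(U₀)X‖ ≤ B₀‖X‖`, the hypothesis `Sat14 (C₁B₃ε₁) (C₁ε₁) V U₀` of the inhabited `B11.Prop3Printed` (= `B11Prop3Model.Inputs` for the datum's
`C`, `H`) HOLDS (`inputs_concrete`). [cite: Balaban1985Variational, (14) p.280, (44)–(46) p.285, (72) p.289] -/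
theorem sat14_concrete {j : ℕ} (hj : j ≤ k) (hd : 1 ≤ d) (Bdry : Type)
    (Hf : (Site d → Fin d → 𝔸ˣ) → ((T → 𝔸) →ₗ[ℂ] (S → 𝔸))) {B₀ : ℝ} (hH : ∀ X, ‖Hf U₀ X‖ ≤ B₀ * ‖X‖)
    (e e' : ℝ) (V : Bdry) :
    let δ : LinDatum (S → 𝔸) (T → 𝔸) (Site d → Fin d → 𝔸ˣ) :=
      { L := L, dim := d, one_le_dim := hd, hop := Hf, Ct := fun U₀ => Cmap L U₀ S T j }
    (δ.toLGData Bdry ((8 * (131072 * ((d : ℝ) + 1) ^ 2) * Real.exp (4 * (800 * ((d : ℝ) + 1) ^ 2 * ((d : ℝ) + 4)) * α₀)) * ((L : ℝ) ^ j) ^ 2) (2 * (d : ℝ) * (C3Gen d L * ((L : ℝ) ^ j) ^ 2)) B₀ (b / 2)).Sat14 e e' V U₀ :=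
  inputs_concrete L hL hG k U₀ hU₀ hα hα3 hα4 h52 hb hsmall hc₃ h145 h155 S T (Hf U₀) hj hH

include hL hG hU₀ hα hα3 hα4 h52 hb hsmall hc₃ h145 h155 in
/-- **The five conclusions of the inhabited `B11.Prop3Printed` ARE IN FORCE at a regular background** (the typed statement applied at the index,
its (14)-hypothesis discharged by `sat14_concrete`): for `0 < ε₁`, `0 < ε₃` with the printed smallness there are the `LGData`-level clauses
`Def47`, range ⊇ (43)_{ε₂ ≤ ε₃/4}, range ⊆ (43)_{2ε₃}, (55), (73)-at-norm-level with the statement's own `O(1)`.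
[cite: Balaban1985Variational, Prop. 3 p.289] -/
theorem prop3Printed_concrete_at {j : ℕ} (hj : j ≤ k) (hd : 1 ≤ d) (Bdry : Type)
    (Hf : (Site d → Fin d → 𝔸ˣ) → ((T → 𝔸) →ₗ[ℂ] (S → 𝔸))) {C₁ B₃ B₀ c1h δ₀ : ℝ} (hB₀ : 0 ≤ B₀) (hc1h : 1 ≤ c1h)
    (hH : ∀ X, ‖Hf U₀ X‖ ≤ B₀ * ‖X‖) :
    let δ : LinDatum (S → 𝔸) (T → 𝔸) (Site d → Fin d → 𝔸ˣ) :=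
      { L := L, dim := d, one_le_dim := hd, hop := Hf, Ct := fun U₀ => Cmap L U₀ S T j }
    let Λ := δ.toLGData Bdry ((8 * (131072 * ((d : ℝ) + 1) ^ 2) * Real.exp (4 * (800 * ((d : ℝ) + 1) ^ 2 * ((d : ℝ) + 4)) * α₀)) * ((L : ℝ) ^ j) ^ 2) (2 * (d : ℝ) * (C3Gen d L * ((L : ℝ) ^ j) ^ 2)) B₀ (b / 2)
    ∃ O₁ : ℝ, 0 < O₁ ∧ ∀ ε₁ ε₃ : ℝ, 0 < ε₁ → 0 < ε₃ →
      18 * ((8 * (131072 * ((d : ℝ) + 1) ^ 2) * Real.exp (4 * (800 * ((d : ℝ) + 1) ^ 2 * ((d : ℝ) + 4)) * α₀)) * ((L : ℝ) ^ j) ^ 2) * B₀ * Λ.dim * c1h * ε₃ ≤ 1 → 2 * ε₃ ≤ b / 2 → ∀ V : Bdry,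
        Λ.Def47 U₀ ε₃ ∧
        (∀ ε₂ : ℝ, ε₂ ≤ ε₃ / 4 → ∀ A : Λ.Fld, Λ.In43 U₀ ε₂ A → ∃ A' : Λ.Fld, Λ.In43 U₀ ε₃ A' ∧ Λ.T47 U₀ A' = A) ∧
        (∀ A' : Λ.Fld, Λ.In43 U₀ ε₃ A' → Λ.In43 U₀ (2 * ε₃) (Λ.T47 U₀ A')) ∧
        (∀ A' : Λ.Fld, Λ.In43 U₀ ε₃ A' → Λ.normD U₀ A' ≤ 4 * ((8 * (131072 * ((d : ℝ) + 1) ^ 2) * Real.exp (4 * (800 * ((d : ℝ) + 1) ^ 2 * ((d : ℝ) + 4)) * α₀)) * ((L : ℝ) ^ j) ^ 2) * Λ.nM1 U₀ A' ^ 2) ∧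
        (∀ A' : Λ.Fld, ∀ c : Λ.Cell, ∀ y : Λ.Site, Λ.In43 U₀ ε₃ A' →
          Λ.kerD U₀ A' c y ≤ O₁ * (2 * (d : ℝ) * (C3Gen d L * ((L : ℝ) ^ j) ^ 2)) * ε₃ *
            (Λ.L ^ Λ.scale y * Λ.eta) ^ (1 - (Λ.dim : ℝ)) * Real.exp (-(δ₀ / 2) * Λ.dist c y)) := by
  intro δ Λ
  obtain ⟨O₁, hO₁, h⟩ := prop3Printed_concrete (I := PUnit) (fun _ => Bdry) hd L (fun _ => S) (fun _ => T) j (fun _ => Hf)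
    (C₁ := C₁) (B₃ := B₃) (δ₀ := δ₀) (α₀ := α₀) hB₀ hb hc1h
  refine ⟨O₁, hO₁, fun ε₁ ε₃ hε₁ hε₃ h18 h2 V => ?_⟩
  exact h PUnit.unit ε₁ ε₃ hε₁ hε₃ h18 h2 V U₀
    (sat14_concrete L hL hG k U₀ hU₀ hα hα3 hα4 h52 hb hsmall hc₃ h145 h155 S T hj hd Bdry Hf hH _ _ V)

end Family

end Literature.MathematicalPhysics.QuantumFieldTheory.Balaban1983to89.B11Prop3Concrete

end
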